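import Mathlib.Analysis.Calculus.ContDiff.Basic
import Mathlib.MeasureTheory.Integral.Lebesgue.Basic
import Mathlib.MeasureTheory.Measure.Haar.InnerProductSpace
import Mathlib.Analysis.InnerProductSpace.PiL2
import Mathlib.Analysis.SpecialFunctions.Pow.Real
import Literature.Geometry.Lorentzian.Basic
import Literature.Geometry.Lorentzian.InitialData
import Literature.Geometry.Lorentzian.AsymptoticFlatness
import HarnessLib

-- provenance: harness21/H21/H21/Prelude/Lorentz/WeightedNorms.lean @ eed0bef (interim HEAD d8f2665); M5 mechanical rewrite
/-!
# Weighted `Cᵏ` and weighted Sobolev seminorms; coordinate energies (trunk T-LORENTZ / G08, C20)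

Family `gr`, notion `weighted_sobolev_manifold` (tier L), statement **gr.S15** ("weighted-Sobolev
AF classes").

This file is a *restricted* realisation of the weighted Sobolev / Hölder scales `H^s_δ`, `C^k_δ`
of Bartnik (CPAM 39 (1986), (1.2)–(1.3)) and Choquet-Bruhat–Christodoulou (Acta Math. 146 (1981)):
we only define the **seminorms of (smooth) functions on subsets of a real normed space** — no
completions, no weak derivatives, no tensor bundles over a manifold. This is enough to type
"the data are `ε`-close in `H^s_δ`" for initial data sets on open subsets `U ⊆ E3 = ℝ³` (the
global-chart case, outline C20; on such `U` the tangent spaces are `E3` definitionally, so `h`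
and `k` are honest functions `E3 → (E3 →L[ℝ] E3 →L[ℝ] ℝ)`), and to type the coordinate
(non-degenerate) energies of scalar waves `ψ` on open subsets of `E4 = ℝ⁴` through the slices
`{t* = τ₀}` (Dafermos–Rodnianski, arXiv:0811.0354, §4–§5; review finding F2).

## Main definitions (namespace `Literature.Lorentz`)

* `weightedCkSeminorm U k δ f = sup_{m ≤ k} sup_{x ∈ U} (1+‖x‖)^{δ+m} ‖D^m f(x)‖ : ℝ≥0∞`.
* `weightedSobolevSeminorm U s δ f = (∑_{m ≤ s} ∫_U (1+‖x‖)^{2(δ+m)} ‖D^m f(x)‖² dx)^{1/2}`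
  (**gr.S15**).
* `InitialDataSet.hFun`, `InitialDataSet.kFun`: for `D : InitialDataSet 𝓘(ℝ, E3) U`, `U : Opens E3`,
  the components `h`, `k` as functions on `E3` (junk values `δ = innerSL ℝ`, `0` off `U`).
* `InitialDataSet.dataWeightedSobolevEDist s δ D₁ D₂`, `InitialDataSet.dataWeightedCkEDist k δ D₁ D₂`:
  the `H^s_δ × H^{s-1}_{δ+1}` (resp. `C^k_δ × C^{k-1}_{δ+1}`) extended distance of two data sets
  on the same `U`.
* `InitialDataSet.weightedSobolevPseudoEMetric s δ`, `InitialDataSet.weightedCkPseudoEMetric k δ`: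
  the corresponding `PseudoEMetricSpace` structures (definitions, **not** instances; use `letI`).
* `sliceEnergy U ψ τ₀`, `localSliceEnergy U ψ τ₀ R`, `weightedSliceEnergy U ψ τ₀ p`: coordinate
  energies `∫_{t* = τ₀} ∑_μ |∂_μ ψ|² dy` of a scalar field `ψ : U → ℝ`, `U : Opens E4`.

## The `δ`-sign convention

We use the **Choquet-Bruhat–Christodoulou / Christodoulou–Klainerman convention**: the weight
on the `m`-th derivative is `(1+‖x‖)^{δ+m}` (sup norms) resp. `(1+‖x‖)^{2(δ+m)}` (squared `L²`
norms), so that *larger `δ` means faster decay* and each derivative gains one power of decay;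
`f ∈ C^k_δ` roughly means `D^m f = O(‖x‖^{-δ-m})`. Bartnik (1986), (1.2)–(1.3), uses the
opposite orientation: his `W^{k,2}_{δ_B}(ℝ³)` has weight `σ^{-2(δ_B - m) - 3}` on `|D^m u|²`
(`σ = (1+|x|²)^{1/2}`), so that `u ∈ W^{k,2}_{δ_B}` roughly means `u = o(r^{δ_B})`. The dictionary in
dimension `3` is `δ = -δ_B - 3/2`; and `1+‖x‖` and `σ` give equivalent seminorms.

## Mathlib

Mathlib has `iteratedFDeriv`, `fderiv`, the Lebesgue integral `∫⁻`, `Real.rpow`, `ENNReal`,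
`Set.indicator`, `Function.extend`, `EuclideanSpace.single`, Lebesgue measure on `EuclideanSpace`
(`measureSpaceOfInnerProductSpace`), `PseudoEMetricSpace`; it has Sobolev-type material only for
Schwartz space / distributions and no weighted Sobolev or weighted `Cᵏ` classes
(`rg -i "weighted sobolev|weightedSobolev"` finds nothing). Nothing here duplicates Mathlib.

## Design choices

* Values in `ℝ≥0∞`, so that no integrability/boundedness hypothesis is needed to *define* the
  seminorms; finiteness is the membership condition (`weightedSobolevSeminorm U s δ f < ∞`).
* `iteratedFDeriv ℝ m f x` is the (junk-extended) global iterated derivative; on an *open* `U` on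
  which `f` is `C^∞` it depends only on `f|_U`, so the seminorms of `hFun D`, `kFun D` over the open
  `U` do not see the junk values off `U`, and the triangle inequalities
  (`dataWeightedSobolevEDist_triangle`, …) hold because all functions involved are smooth on `U`.
* The `k`-component of the data distances uses one derivative less and one more power of decay
  (`s' = s - 1`, `δ' = δ + 1`), as in Christodoulou–Klainerman (1.0.9) / Bartnik's `(h - δ, k) ∈
  H^s_δ × H^{s-1}_{δ+1}`; natural-number subtraction makes `s' = 0` when `s = 0` (documented junk).
* Coordinate energies: `ψ : U → ℝ` is extended by `0` to `E4` (`Function.extend Subtype.val ψ 0`);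
  the integrand is restricted to the slice `{y | (τ₀, y) ∈ U}` by `Set.indicator`, so the junk
  extension is differentiated only at points of the open set `U`.

## References

* R. Bartnik, *The mass of an asymptotically flat manifold*, CPAM 39 (1986), (1.2)–(1.3), Def. 2.1.
* Y. Choquet-Bruhat, D. Christodoulou, *Elliptic systems in `H_{s,δ}` spaces on manifolds which are
  Euclidean at infinity*, Acta Math. 146 (1981), §2.
* D. Christodoulou, S. Klainerman, *The global nonlinear stability of the Minkowski space* (1993),
  §1, (1.0.9).
* M. Dafermos, I. Rodnianski, *Lectures on black holes and linear waves*, arXiv:0811.0354, §4, §5.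
-/

open Manifold Bundle TopologicalSpace MeasureTheory
open scoped ContDiff Topology ENNReal NNReal

noncomputable section

namespace Literature.Geometry.Lorentzian

/-! ### Weighted seminorms of functions on subsets of a normed space -/

section Seminorms

variable {F G : Type*} [NormedAddCommGroup F] [NormedSpace ℝ F] [NormedAddCommGroup G]
  [NormedSpace ℝ G]

/-- The **weighted `Cᵏ_δ` seminorm** of `f : F → G` over the subset `U ⊆ F`:
`sup_{m ≤ k} sup_{x ∈ U} (1 + ‖x‖)^{δ+m} ‖D^m f (x)‖ ∈ [0, ∞]`, with the convention that larger
`δ` means faster decay and each derivative gains one power (see the module docstring for the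
dictionary with Bartnik's `δ`). Bartnik, CPAM 39 (1986), (1.3) (weighted `C^k` norms);
Christodoulou–Klainerman 1993, §1. [cite: ChristodoulouKlainerman1993, §1] -/
def weightedCkSeminorm (U : Set F) (k : ℕ) (δ : ℝ) (f : F → G) : ℝ≥0∞ :=
  ⨆ (m : ℕ) (_ : m ≤ k), ⨆ x ∈ U,
    ENNReal.ofReal ((1 + ‖x‖) ^ (δ + m : ℝ) * ‖iteratedFDeriv ℝ m f x‖)

/-- **gr.S15** (weighted-Sobolev AF classes; Bartnik, CPAM 39 (1986), (1.2)–(1.3);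
Christodoulou–Klainerman 1993, §1). The **weighted Sobolev `H^s_δ` seminorm** of `f : F → G`
over the subset `U ⊆ F` (w.r.t. the measure `volume` of `[MeasureSpace F]`):
`(∑_{m=0}^{s} ∫_U (1 + ‖x‖)^{2(δ+m)} ‖D^m f (x)‖² dx)^{1/2} ∈ [0, ∞]`. Convention: larger `δ`
means faster decay; in dimension `3` our `δ` is `-δ_B - 3/2` for Bartnik's `δ_B` (module
docstring). Only smooth `f` are intended (`iteratedFDeriv` is the classical derivative); this is
the restricted realisation of the notion `weighted_sobolev_manifold` in the global-chart case. [cite: ChristodoulouKlainerman1993, §1] -/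
def weightedSobolevSeminorm [MeasureSpace F] (U : Set F) (s : ℕ) (δ : ℝ) (f : F → G) : ℝ≥0∞ :=
  (∑ m ∈ Finset.range (s + 1),
      ∫⁻ x in U, ENNReal.ofReal ((1 + ‖x‖) ^ (2 * (δ + m) : ℝ) * ‖iteratedFDeriv ℝ m f x‖ ^ 2)) ^
    (1 / 2 : ℝ)

/-- The weighted `Cᵏ_δ` seminorm of the zero function vanishes. Bartnik 1986, (1.3). [cite: Bartnik1986, (1.3] -/
@[simp]
theorem weightedCkSeminorm_zero (U : Set F) (k : ℕ) (δ : ℝ) :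
    weightedCkSeminorm U k δ (0 : F → G) = 0 := by
  simp [weightedCkSeminorm]

/-- The weighted `Cᵏ_δ` seminorm is invariant under `f ↦ -f`. Bartnik 1986, (1.3). [cite: Bartnik1986, (1.3] -/
@[simp]
theorem weightedCkSeminorm_neg (U : Set F) (k : ℕ) (δ : ℝ) (f : F → G) :
    weightedCkSeminorm U k δ (-f) = weightedCkSeminorm U k δ f := by
  simp [weightedCkSeminorm, iteratedFDeriv_neg]

/-- The weighted `Cᵏ_δ` seminorm is monotone in the set. Bartnik 1986, (1.3). [cite: Bartnik1986, (1.3] -/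
theorem weightedCkSeminorm_mono {U V : Set F} (h : U ⊆ V) (k : ℕ) (δ : ℝ) (f : F → G) :
    weightedCkSeminorm U k δ f ≤ weightedCkSeminorm V k δ f := by
  unfold weightedCkSeminorm
  exact iSup₂_mono fun m _ => biSup_mono h

/-- Pointwise weighted bound from finiteness of the `Cᵏ_δ` seminorm: for `m ≤ k` and `x ∈ U`,
`(1+‖x‖)^{δ+m} ‖D^m f(x)‖ ≤ ‖f‖_{C^k_δ(U)}`. Bartnik 1986, (1.3). [cite: Bartnik1986, (1.3] -/
theorem ofReal_mul_norm_iteratedFDeriv_le_weightedCkSeminorm {U : Set F} {k m : ℕ} (hm : m ≤ k)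
    (δ : ℝ) (f : F → G) {x : F} (hx : x ∈ U) :
    ENNReal.ofReal ((1 + ‖x‖) ^ (δ + m : ℝ) * ‖iteratedFDeriv ℝ m f x‖) ≤
      weightedCkSeminorm U k δ f := by
  unfold weightedCkSeminorm
  exact le_iSup₂_of_le m hm (le_iSup₂_of_le x hx le_rfl)

variable [MeasureSpace F]

/-- The weighted Sobolev seminorm of the zero function vanishes. Bartnik 1986, (1.2). [cite: Bartnik1986, (1.2] -/
@[simp]
theorem weightedSobolevSeminorm_zero (U : Set F) (s : ℕ) (δ : ℝ) :
    weightedSobolevSeminorm U s δ (0 : F → G) = 0 := by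
  simp [weightedSobolevSeminorm]

/-- The weighted Sobolev seminorm is invariant under `f ↦ -f`. Bartnik 1986, (1.2). [cite: Bartnik1986, (1.2] -/
@[simp]
theorem weightedSobolevSeminorm_neg (U : Set F) (s : ℕ) (δ : ℝ) (f : F → G) :
    weightedSobolevSeminorm U s δ (-f) = weightedSobolevSeminorm U s δ f := by
  simp [weightedSobolevSeminorm, iteratedFDeriv_neg]

/-- The weighted Sobolev seminorm is monotone in the set. Bartnik 1986, (1.2). [cite: Bartnik1986, (1.2] -/
theorem weightedSobolevSeminorm_mono {U V : Set F} (h : U ⊆ V) (s : ℕ) (δ : ℝ) (f : F → G) :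
    weightedSobolevSeminorm U s δ f ≤ weightedSobolevSeminorm V s δ f := by
  unfold weightedSobolevSeminorm
  gcongr

/-- **Minkowski inequality** for the weighted Sobolev seminorm on an open set, for functions
smooth on that set (where `iteratedFDeriv` is additive). Bartnik 1986, §1 (the `W^{k,p}_δ` are
normed spaces). [cite: Bartnik1986, §1 (the  W^{k p}_δ  are normed spaces] -/
def weightedSobolevSeminorm_add_le : Prop :=
  ∀ [BorelSpace F] {U : Set F} (hU : IsOpen U) (s : ℕ) (δ : ℝ) {f g : F → G} (hf : ContDiffOn ℝ ∞ f U) (hg : ContDiffOn ℝ ∞ g U),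
    weightedSobolevSeminorm U s δ (f + g) ≤
      weightedSobolevSeminorm U s δ f + weightedSobolevSeminorm U s δ g

/-- Triangle inequality for the weighted `Cᵏ_δ` seminorm on an open set, for functions smooth on
that set. Bartnik 1986, (1.3). [cite: Bartnik1986, (1.3] -/
def weightedCkSeminorm_add_le : Prop :=
  ∀ {U : Set F} (hU : IsOpen U) (k : ℕ) (δ : ℝ) {f g : F → G} (hf : ContDiffOn ℝ ∞ f U) (hg : ContDiffOn ℝ ∞ g U),
    weightedCkSeminorm U k δ (f + g) ≤ weightedCkSeminorm U k δ f + weightedCkSeminorm U k δ g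

end Seminorms

/-! ### Weighted distances of initial data sets on open subsets of `ℝ³` -/

namespace InitialDataSet

variable {U : Opens E3}

/-- The **metric components as a function on `E3`**: for data `D = (h, k)` on an open
`U ⊆ E3` (global chart; `TangentSpace 𝓘(ℝ, E3) y = E3` definitionally), `hFun D y = h_y` for
`y ∈ U`, extended by the **junk value** `δ = innerSL ℝ` off `U` (so that `hFun D - innerSL ℝ`
measures the deviation from Euclidean space and vanishes off `U`). Bartnik 1986, (1.3) and
Def. 2.1; Christodoulou–Klainerman 1993, (1.0.9). [cite: Bartnik1986, (1.3] -/
def hFun (D : InitialDataSet 𝓘(ℝ, E3) U) (y : E3) : E3 →L[ℝ] E3 →L[ℝ] ℝ :=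
  open scoped Classical in
  if hy : y ∈ U then D.h.inner ⟨y, hy⟩ else innerSL ℝ

/-- The **second fundamental form as a function on `E3`**: `kFun D y = k_y` for `y ∈ U`, extended
by the **junk value** `0` off `U`. Christodoulou–Klainerman 1993, (1.0.9). [cite: ChristodoulouKlainerman1993, (1.0.9] -/
def kFun (D : InitialDataSet 𝓘(ℝ, E3) U) (y : E3) : E3 →L[ℝ] E3 →L[ℝ] ℝ :=
  open scoped Classical in
  if hy : y ∈ U then D.k ⟨y, hy⟩ else 0

/-- On `U`, `hFun` is the metric. Bartnik 1986, (1.3). [cite: Bartnik1986, (1.3] -/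
@[simp]
theorem hFun_of_mem (D : InitialDataSet 𝓘(ℝ, E3) U) {y : E3} (hy : y ∈ U) :
    D.hFun y = D.h.inner ⟨y, hy⟩ :=
  dif_pos hy

/-- Off `U`, `hFun` is the junk value `δ`. Bartnik 1986, (1.3). [cite: Bartnik1986, (1.3] -/
@[simp]
theorem hFun_of_not_mem (D : InitialDataSet 𝓘(ℝ, E3) U) {y : E3} (hy : y ∉ U) :
    D.hFun y = innerSL ℝ :=
  dif_neg hy

/-- On `U`, `kFun` is the second fundamental form. Christodoulou–Klainerman 1993, (1.0.9). [cite: ChristodoulouKlainerman1993, (1.0.9] -/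
@[simp]
theorem kFun_of_mem (D : InitialDataSet 𝓘(ℝ, E3) U) {y : E3} (hy : y ∈ U) :
    D.kFun y = D.k ⟨y, hy⟩ :=
  dif_pos hy

/-- Off `U`, `kFun` is the junk value `0`. Christodoulou–Klainerman 1993, (1.0.9). [cite: ChristodoulouKlainerman1993, (1.0.9] -/
@[simp]
theorem kFun_of_not_mem (D : InitialDataSet 𝓘(ℝ, E3) U) {y : E3} (hy : y ∉ U) :
    D.kFun y = 0 :=
  dif_neg hy

/-- The metric components of data on an open `U ⊆ E3` are smooth on `U` (a `C^∞` section of the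
trivial bundle `Hom(TU, Hom(TU, ℝ))` read in the identity chart). Bartnik 1986, §1. [cite: Bartnik1986, §1] -/
def contDiffOn_hFun : Prop :=
  ∀ (D : InitialDataSet 𝓘(ℝ, E3) U),
    ContDiffOn ℝ ∞ D.hFun U

/-- The components of `k` of data on an open `U ⊆ E3` are smooth on `U`.
Christodoulou–Klainerman 1993, §1. [cite: ChristodoulouKlainerman1993, §1] -/
def contDiffOn_kFun : Prop :=
  ∀ (D : InitialDataSet 𝓘(ℝ, E3) U),
    ContDiffOn ℝ ∞ D.kFun U

/-- The **weighted Sobolev distance of two initial data sets** on the same open `U ⊆ E3`: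
`‖h₁ - h₂‖_{H^s_δ(U)} + ‖k₁ - k₂‖_{H^{s-1}_{δ+1}(U)} ∈ [0, ∞]` — the `k`-part has one derivative
less and one more power of decay (Christodoulou–Klainerman 1993, (1.0.9): `h - δ ∈ o₂/H^s_δ`,
`k ∈ H^{s-1}_{δ+1}`; Bartnik 1986, (1.2)). For `s = 0` natural-number subtraction gives the
(junk) order `0` for the `k`-part as well. This is the topology in which "data `ε`-close to
Minkowski/Schwarzschild/Kerr data" is typed. [cite: ChristodoulouKlainerman1993, (1.0.9] -/
def dataWeightedSobolevEDist (s : ℕ) (δ : ℝ) (D₁ D₂ : InitialDataSet 𝓘(ℝ, E3) U) : ℝ≥0∞ :=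
  weightedSobolevSeminorm (U : Set E3) s δ (D₁.hFun - D₂.hFun) +
    weightedSobolevSeminorm (U : Set E3) (s - 1) (δ + 1) (D₁.kFun - D₂.kFun)

/-- The **weighted `Cᵏ` distance of two initial data sets** on the same open `U ⊆ E3`:
`‖h₁ - h₂‖_{C^k_δ(U)} + ‖k₁ - k₂‖_{C^{k-1}_{δ+1}(U)} ∈ [0, ∞]` (for `k = 0` the `k`-part has the
junk order `0`). Bartnik 1986, (1.3), Def. 2.1; Christodoulou–Klainerman 1993, (1.0.9). [cite: Bartnik1986, (1.3] -/
def dataWeightedCkEDist (k : ℕ) (δ : ℝ) (D₁ D₂ : InitialDataSet 𝓘(ℝ, E3) U) : ℝ≥0∞ :=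
  weightedCkSeminorm (U : Set E3) k δ (D₁.hFun - D₂.hFun) +
    weightedCkSeminorm (U : Set E3) (k - 1) (δ + 1) (D₁.kFun - D₂.kFun)

/-- The weighted Sobolev distance of a data set to itself is `0`. Bartnik 1986, (1.2). [cite: Bartnik1986, (1.2] -/
@[simp]
theorem dataWeightedSobolevEDist_self (s : ℕ) (δ : ℝ) (D : InitialDataSet 𝓘(ℝ, E3) U) :
    dataWeightedSobolevEDist s δ D D = 0 := by
  have h₁ : D.hFun - D.hFun = 0 := funext fun y => sub_self (D.hFun y)
  have h₂ : D.kFun - D.kFun = 0 := funext fun y => sub_self (D.kFun y)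
  rw [dataWeightedSobolevEDist, h₁, h₂, weightedSobolevSeminorm_zero, weightedSobolevSeminorm_zero,
    add_zero]

/-- The weighted Sobolev distance of data sets is symmetric. Bartnik 1986, (1.2). [cite: Bartnik1986, (1.2] -/
theorem dataWeightedSobolevEDist_comm (s : ℕ) (δ : ℝ) (D₁ D₂ : InitialDataSet 𝓘(ℝ, E3) U) :
    dataWeightedSobolevEDist s δ D₁ D₂ = dataWeightedSobolevEDist s δ D₂ D₁ := by
  have h₁ : D₁.hFun - D₂.hFun = -(D₂.hFun - D₁.hFun) :=
    funext fun y => (neg_sub (D₂.hFun y) (D₁.hFun y)).symm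
  have h₂ : D₁.kFun - D₂.kFun = -(D₂.kFun - D₁.kFun) :=
    funext fun y => (neg_sub (D₂.kFun y) (D₁.kFun y)).symm
  rw [dataWeightedSobolevEDist, dataWeightedSobolevEDist, h₁, h₂, weightedSobolevSeminorm_neg,
    weightedSobolevSeminorm_neg]

/-- **Triangle inequality** for the weighted Sobolev distance of data sets (Minkowski's
inequality; the components are smooth on the open set `U`, `contDiffOn_hFun`). Bartnik 1986,
§1. [cite: Bartnik1986, §1] -/
def dataWeightedSobolevEDist_triangle : Prop :=
  ∀ (s : ℕ) (δ : ℝ) (D₁ D₂ D₃ : InitialDataSet 𝓘(ℝ, E3) U),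
    dataWeightedSobolevEDist s δ D₁ D₃ ≤
      dataWeightedSobolevEDist s δ D₁ D₂ + dataWeightedSobolevEDist s δ D₂ D₃

/-- The weighted `Cᵏ` distance of a data set to itself is `0`. Bartnik 1986, (1.3). [cite: Bartnik1986, (1.3] -/
@[simp]
theorem dataWeightedCkEDist_self (k : ℕ) (δ : ℝ) (D : InitialDataSet 𝓘(ℝ, E3) U) :
    dataWeightedCkEDist k δ D D = 0 := by
  have h₁ : D.hFun - D.hFun = 0 := funext fun y => sub_self (D.hFun y)
  have h₂ : D.kFun - D.kFun = 0 := funext fun y => sub_self (D.kFun y)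
  rw [dataWeightedCkEDist, h₁, h₂, weightedCkSeminorm_zero, weightedCkSeminorm_zero, add_zero]

/-- The weighted `Cᵏ` distance of data sets is symmetric. Bartnik 1986, (1.3). [cite: Bartnik1986, (1.3] -/
theorem dataWeightedCkEDist_comm (k : ℕ) (δ : ℝ) (D₁ D₂ : InitialDataSet 𝓘(ℝ, E3) U) :
    dataWeightedCkEDist k δ D₁ D₂ = dataWeightedCkEDist k δ D₂ D₁ := by
  have h₁ : D₁.hFun - D₂.hFun = -(D₂.hFun - D₁.hFun) :=
    funext fun y => (neg_sub (D₂.hFun y) (D₁.hFun y)).symm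
  have h₂ : D₁.kFun - D₂.kFun = -(D₂.kFun - D₁.kFun) :=
    funext fun y => (neg_sub (D₂.kFun y) (D₁.kFun y)).symm
  rw [dataWeightedCkEDist, dataWeightedCkEDist, h₁, h₂, weightedCkSeminorm_neg,
    weightedCkSeminorm_neg]

/-- **Triangle inequality** for the weighted `Cᵏ` distance of data sets. Bartnik 1986, (1.3). [cite: Bartnik1986, (1.3] -/
def dataWeightedCkEDist_triangle : Prop :=
  ∀ (k : ℕ) (δ : ℝ) (D₁ D₂ D₃ : InitialDataSet 𝓘(ℝ, E3) U),
    dataWeightedCkEDist k δ D₁ D₃ ≤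
      dataWeightedCkEDist k δ D₁ D₂ + dataWeightedCkEDist k δ D₂ D₃

/-- The **weighted Sobolev pseudo-emetric structure** `H^s_δ × H^{s-1}_{δ+1}` on the initial data
sets on a fixed open `U ⊆ E3` (a definition, not an instance: write
`letI := InitialDataSet.weightedSobolevPseudoEMetric (U := U) htri s δ` to speak of `EMetric.ball D ε`,
`𝓝 D`, `Dense`, …). The triangle inequality `dataWeightedSobolevEDist_triangle` is the hypothesis
`htri`. Bartnik 1986, (1.2); Christodoulou–Klainerman 1993, (1.0.9). [cite: Bartnik1986, (1.2] -/
@[reducible]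
def weightedSobolevPseudoEMetric (htri : dataWeightedSobolevEDist_triangle (U := U)) (s : ℕ) (δ : ℝ) :
    PseudoEMetricSpace (InitialDataSet 𝓘(ℝ, E3) U) where
  edist := dataWeightedSobolevEDist s δ
  edist_self := dataWeightedSobolevEDist_self s δ
  edist_comm := dataWeightedSobolevEDist_comm s δ
  edist_triangle := htri s δ

/-- The **weighted `Cᵏ` pseudo-emetric structure** `C^k_δ × C^{k-1}_{δ+1}` on the initial data
sets on a fixed open `U ⊆ E3` (a definition, not an instance; use `letI`). The triangle inequality
`dataWeightedCkEDist_triangle` is the hypothesis `htri`. Bartnik 1986, (1.3), Def. 2.1. [cite: Bartnik1986, (1.3] -/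
@[reducible]
def weightedCkPseudoEMetric (htri : dataWeightedCkEDist_triangle (U := U)) (k : ℕ) (δ : ℝ) :
    PseudoEMetricSpace (InitialDataSet 𝓘(ℝ, E3) U) where
  edist := dataWeightedCkEDist k δ
  edist_self := dataWeightedCkEDist_self k δ
  edist_comm := dataWeightedCkEDist_comm k δ
  edist_triangle := htri k δ

end InitialDataSet

/-! ### Coordinate energies of scalar fields through the slices `{t* = τ₀}` -/

section Energy

variable (U : Opens E4) (ψ : U → ℝ) (τ₀ : ℝ)

/-- The **coordinate energy density** `∑_{μ=0}^{3} (∂_μ ψ̃)² (x)` of (the extension by zero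
`ψ̃ = Function.extend Subtype.val ψ 0 : E4 → ℝ` of) a scalar field `ψ : U → ℝ` at `x : E4`, with
`∂_μ = fderiv ℝ ψ̃ x e_μ`, `e_μ = EuclideanSpace.single μ 1`. On the open set `U` this is the
honest sum of squares of all first partial derivatives of `ψ` (a non-degenerate energy density,
comparable to `J^N_μ n^μ` on `{t* = τ₀}`; Dafermos–Rodnianski, arXiv:0811.0354, §4.1 and
App. C). Off `U` it is junk and never used. [cite: arXiv08110354] -/
def coordEnergyDensity (x : E4) : ℝ :=
  ∑ μ : Fin 4, (fderiv ℝ (Function.extend Subtype.val ψ (0 : E4 → ℝ)) x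
    (EuclideanSpace.single μ (1 : ℝ))) ^ 2

/-- The coordinate energy density is nonnegative (sum of squares). DR arXiv:0811.0354, §4.1. [cite: arXiv08110354] -/
theorem coordEnergyDensity_nonneg (x : E4) : 0 ≤ coordEnergyDensity U ψ x :=
  Finset.sum_nonneg fun _ _ => sq_nonneg _

/-- The **coordinate (non-degenerate) energy** of `ψ : U → ℝ` through the slice `{t* = τ₀}`:
`∫_{y ∈ E3, (τ₀, y) ∈ U} ∑_μ (∂_μ ψ)² (τ₀, y) dy ∈ [0, ∞]` (Lebesgue measure on `E3`; the
integrand is cut off to the slice of `U` by `Set.indicator`). Dafermos–Rodnianski,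
arXiv:0811.0354, §4.1 (energy w.r.t. a strictly timelike multiplier `N`) and §5.2 (Kerr
`{t* = τ}` slices); review finding F2. [cite: arXiv08110354] -/
def sliceEnergy : ℝ≥0∞ :=
  ∫⁻ y : E3, Set.indicator {y | E4.ofTimeSpace τ₀ y ∈ U}
    (fun y ↦ ENNReal.ofReal (coordEnergyDensity U ψ (E4.ofTimeSpace τ₀ y))) y

/-- The **local coordinate energy** of `ψ` through `{t* = τ₀} ∩ {‖y‖ ≤ R}`: the same integrand
as `sliceEnergy`, integrated over the closed coordinate ball `Metric.closedBall 0 R ⊆ E3` only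
(the quantity that decays in local-energy-decay statements). Dafermos–Rodnianski,
arXiv:0811.0354, §4.2, §5.3. [cite: arXiv08110354] -/
def localSliceEnergy (R : ℝ) : ℝ≥0∞ :=
  ∫⁻ y in Metric.closedBall (0 : E3) R, Set.indicator {y | E4.ofTimeSpace τ₀ y ∈ U}
    (fun y ↦ ENNReal.ofReal (coordEnergyDensity U ψ (E4.ofTimeSpace τ₀ y))) y

/-- The **weighted coordinate energy** of `ψ` through `{t* = τ₀}` with weight `(1 + ‖y‖)^p`:
`∫_{(τ₀, y) ∈ U} (1 + ‖y‖)^p ∑_μ (∂_μ ψ)² (τ₀, y) dy` (`p = 0` is `sliceEnergy`; `p = 2` is the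
conformal-type energy entering `r^p`-weighted decay hierarchies). Dafermos–Rodnianski,
arXiv:0811.0354, §4.2–§4.3. [cite: arXiv08110354] -/
def weightedSliceEnergy (p : ℝ) : ℝ≥0∞ :=
  ∫⁻ y : E3, Set.indicator {y | E4.ofTimeSpace τ₀ y ∈ U}
    (fun y ↦ ENNReal.ofReal ((1 + ‖y‖) ^ p * coordEnergyDensity U ψ (E4.ofTimeSpace τ₀ y))) y

/-- The local energy is bounded by the total slice energy. DR arXiv:0811.0354, §4. [cite: arXiv08110354] -/
theorem localSliceEnergy_le_sliceEnergy (R : ℝ) :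
    localSliceEnergy U ψ τ₀ R ≤ sliceEnergy U ψ τ₀ :=
  setLIntegral_le_lintegral _ _

/-- The local energy is monotone in the radius. DR arXiv:0811.0354, §4. [cite: arXiv08110354] -/
theorem localSliceEnergy_mono {R R' : ℝ} (h : R ≤ R') :
    localSliceEnergy U ψ τ₀ R ≤ localSliceEnergy U ψ τ₀ R' :=
  lintegral_mono_set (Metric.closedBall_subset_closedBall h)

/-- The weighted energy with weight exponent `p = 0` is the slice energy. DR arXiv:0811.0354,
§4. [cite: arXiv08110354] -/
@[simp]
theorem weightedSliceEnergy_zero : weightedSliceEnergy U ψ τ₀ 0 = sliceEnergy U ψ τ₀ := by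
  simp [weightedSliceEnergy, sliceEnergy]

/-- The slice energy is dominated by the weighted energy for `p ≥ 0` (the weight is `≥ 1`).
DR arXiv:0811.0354, §4. [cite: arXiv08110354] -/
theorem sliceEnergy_le_weightedSliceEnergy {p : ℝ} (hp : 0 ≤ p) :
    sliceEnergy U ψ τ₀ ≤ weightedSliceEnergy U ψ τ₀ p := by
  refine lintegral_mono fun y => Set.indicator_le_indicator ?_
  refine ENNReal.ofReal_le_ofReal (le_mul_of_one_le_left (coordEnergyDensity_nonneg U ψ _) ?_)
  exact Real.one_le_rpow (by simp) hp

end Energy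

end Literature.Geometry.Lorentzian

end
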